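import Summits.HodgeConjecture.HodgeConjecture.Theorems.LinearSystemTorelliLocalTubeSpanThm29
import Mathlib.Algebra.Ring.Int.Parity

/-!
# Route LinearSystemTorelli — crux `LocalTubeSpan` (stmt-HodgeConjecture-2490): primitive vectors of a unimodular plane are vanishing cycles

Helper file (`--supports stmt-HodgeConjecture-2490`, line `Sketch` of the crux chain, cycle 9,
continuation lead c7; the lead's stub `stub_primitive_mem`, worker S1).

Setting: an alternating form `B` on a `ℚ`-space `V`, a skew vanishing lattice `Δ`
(`IsSkewVanishingLattice`, lattice `ℤΔ := Submodule.span ℤ Δ`), and a unimodular pair of vanishing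
cycles `u, w ∈ Δ`, `B(u, w) = 1`.  MAIN THEOREM `localTubeSpan_primitive_mem`: for coprime integers
`α, β` the primitive vector `αu + βw` of the plane `ℤu ⊕ ℤw` lies in `Δ`.

Proof, by Janssen's Theorem 2.9 (`localTubeSpan_janssen1983_thm2_9_holds`, [Janssen1983] Thm. 2.9:
`x ∈ ℤΔ` lies in `Δ` iff `B(x, y) = 1` for some `y ∈ ℤΔ` and `x ≡ δ (mod 2ℤΔ)` for some `δ ∈ Δ`).
* UNIMODULAR: a Bézout relation `aα + bβ = 1` gives `y := -b u + a w ∈ ℤΔ` with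
  `B(αu + βw, y) = αa + βb = 1` (`B(u, u) = B(w, w) = 0`, `B(w, u) = -1`).
* CLASS: `α, β` are not both even (`2 ∣ aα + bβ = 1` otherwise); in the remaining cases
  `(α, β) = (2k, 2l + 1)`, `(2k + 1, 2l)`, `(2k + 1, 2l + 1)` the vector `αu + βw - δ` equals
  `2(ku + lw) ∈ 2ℤΔ` for `δ := w`, `u`, `u + w` respectively, and these lie in `Δ`
  (`u + w = T_w⁻¹ u`, `localTubeSpan_pairMoves_add_mem`).

References: [Janssen1983] W. A. M. Janssen, *Skew-symmetric vanishing lattices and their monodromy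
groups*, Math. Ann. 266 (1983), Thm. 2.9.  No named facts; no `sorry`.
-/

-- `Summit.HodgeConjecture.HodgeConjecture.Theorems` is the mandated namespace (single-conjunct summit:
-- Sub = Summit), which `linter.dupNamespace` flags on every declaration; the lakefile turns the
-- linter off tree-wide (weak option), restated here so stand-alone elaboration is warning-free too.
set_option linter.dupNamespace false

noncomputable section

open Literature.AlgebraicGeometry.HodgeTheory

namespace Summit.HodgeConjecture.HodgeConjecture.Theorems

variable {V : Type} [AddCommGroup V] [Module ℚ V]

/-- Pairing of two vectors of a unimodular plane of an alternating form: for `B(u, w) = 1`,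
`B(au + bw, cu + dw) = ad - bc`. [folklore] -/
theorem localTubeSpan_primitiveMem_pairing (B : LinearMap.BilinForm ℚ V) (hB : B.IsAlt) {u w : V}
    (huw : B u w = 1) (a b c d : ℚ) : B (a • u + b • w) (c • u + d • w) = a * d - b * c := by
  have hwu : B w u = -1 := by rw [← hB.neg_eq, huw]
  simp only [map_add, map_smul, LinearMap.add_apply, LinearMap.smul_apply, smul_eq_mul,
    hB.self_eq_zero, huw, hwu]
  ring

/-- Integer combinations of two lattice vectors are lattice vectors: for `u, w ∈ ℤΔ` and `a, b ∈ ℤ`,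
`au + bw ∈ ℤΔ` (rational scalars that are integer casts). [folklore] -/
theorem localTubeSpan_primitiveMem_comb_mem (Δ : Set V) {u w : V} (hu : u ∈ Submodule.span ℤ Δ)
    (hw : w ∈ Submodule.span ℤ Δ) (a b : ℤ) :
    (a : ℚ) • u + (b : ℚ) • w ∈ Submodule.span ℤ Δ :=
  Submodule.add_mem _ (localTubeSpan_intCast_smul_mem Δ hu a) (localTubeSpan_intCast_smul_mem Δ hw b)

/-- **Primitive vectors of a unimodular plane are vanishing cycles.**  For an alternating form `B`,
a skew vanishing lattice `Δ`, a unimodular pair `u, w ∈ Δ` (`B(u, w) = 1`) and coprime integers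
`α, β`, the vector `αu + βw` lies in `Δ`.  (Janssen's Theorem 2.9: `αu + βw` is unimodular —
`B(αu + βw, -bu + aw) = aα + bβ = 1` for a Bézout pair `a, b` — and congruent modulo `2ℤΔ` to
`u`, `w` or `u + w ∈ Δ` according to the parities of `α, β`, which are not both even.)
[cite: Janssen1983, Thm. 2.9] -/
theorem localTubeSpan_primitive_mem (B : LinearMap.BilinForm ℚ V) (hB : B.IsAlt) (Δ : Set V)
    (hΔ : IsSkewVanishingLattice B Δ) {u w : V} (hu : u ∈ Δ) (hw : w ∈ Δ) (huw : B u w = 1)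
    (α β : ℤ) (hαβ : IsCoprime α β) : (α : ℚ) • u + (β : ℚ) • w ∈ Δ := by
  have huℤ : u ∈ Submodule.span ℤ Δ := Submodule.subset_span hu
  have hwℤ : w ∈ Submodule.span ℤ Δ := Submodule.subset_span hw
  obtain ⟨a, b, hab⟩ := hαβ
  refine (localTubeSpan_janssen1983_thm2_9_holds V B hB Δ hΔ _
    (localTubeSpan_primitiveMem_comb_mem Δ huℤ hwℤ α β)).2 ⟨?_, ?_⟩
  · -- unimodular: `y := -b u + a w`
    refine ⟨((-b : ℤ) : ℚ) • u + (a : ℚ) • w, localTubeSpan_primitiveMem_comb_mem Δ huℤ hwℤ (-b) a,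
      ?_⟩
    have hab' : (a : ℚ) * α + b * β = 1 := by exact_mod_cast hab
    rw [localTubeSpan_primitiveMem_pairing B hB huw]
    push_cast
    linear_combination hab'
  · -- the class modulo `2ℤΔ`: case on the parities of `α, β`
    obtain ⟨k, rfl | rfl⟩ := Int.even_or_odd' α <;> obtain ⟨l, rfl | rfl⟩ := Int.even_or_odd' β
    · -- both even: impossible for a coprime pair
      exfalso
      have h2 : (2 : ℤ) ∣ 1 := ⟨a * k + b * l, by linear_combination -hab⟩
      omega
    · -- `α` even, `β` odd: `δ := w`
      refine ⟨w, hw, (k : ℚ) • u + (l : ℚ) • w, localTubeSpan_primitiveMem_comb_mem Δ huℤ hwℤ k l,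
        ?_⟩
      rw [two_nsmul]
      push_cast
      module
    · -- `α` odd, `β` even: `δ := u`
      refine ⟨u, hu, (k : ℚ) • u + (l : ℚ) • w, localTubeSpan_primitiveMem_comb_mem Δ huℤ hwℤ k l,
        ?_⟩
      rw [two_nsmul]
      push_cast
      module
    · -- both odd: `δ := u + w ∈ Δ` (`u + w = T_w⁻¹ u`)
      refine ⟨u + w, localTubeSpan_pairMoves_add_mem B hB Δ hΔ hu hw huw, (k : ℚ) • u + (l : ℚ) • w,
        localTubeSpan_primitiveMem_comb_mem Δ huℤ hwℤ k l, ?_⟩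
      rw [two_nsmul]
      push_cast
      module

end Summit.HodgeConjecture.HodgeConjecture.Theorems

end
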